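import Literature.AlgebraicGeometry.Resolution.RegularLocalRingsFlatDescent
import Literature.AlgebraicGeometry.Resolution.DecompositionLayerFrame
import Literature.AlgebraicGeometry.Resolution.NormalModels
import Literature.AlgebraicGeometry.Resolution.MonoidalTransformStep
import Mathlib.RingTheory.Smooth.IntegralClosure
import Mathlib.FieldTheory.Minpoly.IsIntegrallyClosed
import Mathlib.RingTheory.Flat.Localization
import Mathlib.RingTheory.Flat.Stability
import Mathlib.RingTheory.Localization.Integral
import HarnessLib

/-!
# InertDescentLU — INERT DESCENT: regularity comes down through ANY standard-étale witness tower (g28, lens 1)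

**Node g28 of the ROOT/RESIDUAL decomposition cell `decomp-res`, lens 1 («grading / quantitative ladder»), window
(W-inert) of critic row 207.**  Problem side, sorry-free, HYPOTHESIS-FREE (no `def : Prop` fact binder anywhere).

## Thesis
g27 consumed the DECOMPOSITION layer `K ⊆ K′ ⊆ K^h` of [CossartPiltant2008, Prop. 9.3] in witness currency: the
witnesses had `K`-RATIONAL RESIDUES, so that `K′` sits in the decomposition field of a Galois closure and the
tree's decomposition-layer engine (trivial residue extension, (44)(45)) applies.  This node removes the residue
clause: THE LAW `relLU_of_unramifiedWitnessLUAbove : UnramifiedWitnessLUAbove k O → RelLocalUniformization k K O`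
is proved on g27's VERBATIM residue-free cell (`DecompositionDescentLU.UnramifiedWitnessLUAbove`, typed in g27 for
the record), WHOLE — inert layers `K^h ⊊ K^{sh}` with ANY separable residue extension included, no casing.

## The engine (parts 1–3, frame of a big field `E ⊇ O_E`)
For ONE witness `x ∈ O_E`, root of a monic `f ∈ B[X]` with `v(f′(x)) = 0`, over a subring `B ⊆ O_E` whose local
ring at the centre `A = B_𝔪` is Noetherian and integrally closed:
* DOWN (`isRegularLocalRing_of_adjoin_integral`): `A[x]` is FREE over `A` (`Algebra.adjoin.powerBasis'`, `A`
  normal), so `A₁ = (A[x])_𝔪` is FLAT over `A` and `A → A₁` is local; regularity of `A₁` descends to `A` by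
  FAITHFULLY FLAT DESCENT [Matsumura1986, Thm. 23.7 (i)] = the tree's `IsRegularLocalRing.of_flat_of_isLocalHom`
  (`Literature/…/RegularLocalRingsFlatDescent.lean`; INVENTORY: this is F3⁺ — already a kernel theorem, stronger
  than the «𝔪-extension + equal dimension» form, so no new descent lemma is needed and none is carried);
* UP (`isIntegrallyClosed_locAtCentre_adjoin`): `A₁` is again INTEGRALLY CLOSED — the minimal polynomial `h` of
  `x` divides `f` over the normal ring `A`, so `h′(x)` is a unit at the centre; an element `z ∈ Frac A₁ = L(x)`
  integral over `A₁` has `s z` integral over `A` for some `s ∈ A[x]` off the centre, and `h′(x)·s z ∈ A[x]` by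
  Mathlib's [Stacks 03GD] `exists_derivative_mul_eq_and_isIntegral_coeff` (Tate); so `z ∈ (A[x])_𝔪`
  (INVENTORY: this is F2′ = [EGA IV₄ 18.10.x]/[Stacks 033C] for one witness — discharged, not carried);
  Noetherianity goes up too (`isNoetherianRing_locAtCentre_adjoin`).
* TOWER (`isRegularLocalRing_locAtCentre_of_witnesses`): induction on finitely many witnesses; the model
  corollary `exists_normalModel_regular_of_witnesses` feeds it with the NORMAL model `k[t₁] ⊇ k[s]` of `M`
  (tree `exists_adjoin_isIntegrallyClosedIn`; `t₁ ⊆ (k[s ∪ x′])_𝔪` because a regular local ring is normal, so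
  `(k[t₁ ∪ x′])_𝔪 = (k[s ∪ x′])_𝔪`; `(k[t₁])_𝔪` is normal by the tree's `isIntegrallyClosed_locAtCentre`).
No decomposition / inertia group, no Galois closure, no completion, no residue field hypothesis.

## The law, the residual, the cuts, the root (parts 4–6)
* `relLU_of_unramifiedWitnessLUAbove` (part 4): cell clause for the model `R` itself; read in `K̄` over `M = K`;
  engine; pull back; transport of the local ring along `K ≅ ι(K)` (as in g27).
* R28 `NonKHToricArchLUKeyHenselDescentQuotInert e c n` (part 5) := g27's R27 binders ∧ `¬ UnramifiedWitnessLUAbove`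
  (note `¬ Unramified ⇒ ¬ DecWitness`, `not_decWitnessLUAbove_of_not_unramifiedWitnessLUAbove`); exact cuts
  `R25 ↔ R28` (part 5), `R27 ↔ R28` (part 6, after g27's slice 5), `R23 ↔ R28`, `NonKHToricArchLU ↔ R28`; the
  decided piece `…QuotInertCell` (`_holds`); `closes_inert` = ROOT BY NAME modulo (CP floor, CJS, Π₁ `KK05NCVAscent`,
  `∀ d ≥ 4, R28 3 3 d`, 0642 `Valuative.PatchingRel`); `root_iff_inert_sigma`.
* Said openly (part 6): `UnramifiedWitnessLUAbove k O ↔ RelLocalUniformization k K O` — every place uniformizable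
  below is in the cell with `x′ = ∅`; the content of the law is the genuine inert tops.
* HONEST LOCATED RESIDUAL (R28 docstring): the standard-étale-witness axis is consumed WHOLE; left for lens 1 are
  tame ramification with residues not in `k` ((W-α) whole), wild ramification ((W-wild) mod D), defect ((K-D),(K-c)).

## Paper instance (NODE-g28.md §5): the inert quadratic top `K′ = K(√a)`, `a ∈ O^×`, `ā ∉ κ(O)²`, `char κ ≠ 2`,
over a non-Abhyankar base: `G = G_Z = ℤ/2`, `G_T = 1`, witness `x = √a`, `h = X² − a`, `h′(x) = 2x ∈ O_E^×`.

Sources: [cite: CossartPiltant2008, Prop. 9.3 and Problem 9.2 (HAL pp. 26–28)] · [cite: Matsumura1986, Thm. 23.7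
(i), p. 181] · [cite: StacksProject, Tag 03GD; Tag 033C] · [cite: EGAIV4, Prop. (18.10.16)] · [cite: KnafKuhlmann2005,
Thm. 1.1] (the ascent Π₁ named in `closes_inert`).
-/

noncomputable section

open IsLocalRing Polynomial Literature.AlgebraicGeometry.Resolution

namespace Summit.ResolutionOfSingularities.ResolutionOfSingularities.Theorems.InertDescentLU

universe u

variable {E : Type u} [Field E] (OE : ValuationSubring E)

/-! ## PART A — helpers; ONE WITNESS DOWN: regularity of `(A[x])_𝔪` descends to the normal base `A = B_𝔪`
(free ⇒ flat, local; faithfully flat descent = the tree's Matsumura 23.7 (i)) -/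

/-! ### S1. Elementary facts in the frame of a big field `E` with a valuation ring `O_E` -/

/-- The value of a polynomial with coefficients in a subring at a point of that subring lies in it.
[folklore] -/
theorem eval_mem_of_coeff_mem (S : Subring E) {f : E[X]} (hf : ∀ i, f.coeff i ∈ S) {x : E}
    (hx : x ∈ S) : f.eval x ∈ S := by
  rw [Polynomial.eval_eq_sum_range]
  exact Subring.sum_mem _ fun i _ => Subring.mul_mem _ (hf i) (Subring.pow_mem _ hx i)

/-- The local ring at the centre of a Noetherian subring is Noetherian (a localization). [folklore] -/
theorem isNoetherianRing_locAtCentre {B : Subring E} (h : B ≤ OE.toSubring) [IsNoetherianRing B] :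
    IsNoetherianRing (locAtCentre B OE) :=
  haveI := isLocalization_locAtCentre h
  IsLocalization.isNoetherianRing (subringCentre B OE h).primeCompl (locAtCentre B OE) inferInstance

/-- A polynomial of `E[X]` with coefficients in a subring `S` is the image of a polynomial of `S[X]`,
monic if the given one is. [folklore] -/
theorem exists_map_eq_of_coeff_mem_subring (S : Subring E) {f : E[X]} (hf : ∀ i, f.coeff i ∈ S)
    (hfm : f.Monic) : ∃ f₀ : Polynomial S, f₀.map (algebraMap S E) = f ∧ f₀.Monic := by
  have hl : f ∈ Polynomial.lifts (algebraMap S E) := by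
    rw [Polynomial.lifts_iff_coeff_lifts]
    intro i
    exact ⟨⟨f.coeff i, hf i⟩, rfl⟩
  obtain ⟨f₀, hf₀, -, hf₀m⟩ := Polynomial.lifts_and_degree_eq_and_monic hl hfm
  exact ⟨f₀, hf₀, hf₀m⟩

/-- A root in `E` of a monic polynomial with coefficients in a subring `S` is integral over `S`.
[folklore] -/
theorem isIntegral_of_monic_root (S : Subring E) {f : E[X]} (hf : ∀ i, f.coeff i ∈ S)
    (hfm : f.Monic) {x : E} (hfx : f.eval x = 0) : IsIntegral S x := by
  obtain ⟨f₀, hf₀, hf₀m⟩ := exists_map_eq_of_coeff_mem_subring S hf hfm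
  refine ⟨f₀, hf₀m, ?_⟩
  rw [Polynomial.eval₂_eq_eval_map, hf₀, hfx]

/-! ### S2. One standard-étale witness over a normal local ring at the centre: flatness and descent

Frame: `B ⊆ O_E` a subring, `A = locAtCentre B O_E` its local ring at the centre, `x ∈ O_E` a root of a
MONIC `f` with coefficients in `B` and `v(f′(x)) = 0` (a standard-étale WITNESS over `B`), `B′ = B[x]`,
`A₁ = locAtCentre B′ O_E = (A[x])_𝔪`.  If `A` is Noetherian and integrally closed then `A[x] ≅ A[X]/(h)`
(`h` the minimal polynomial) is FREE over `A`, so `A → A₁` is a FLAT LOCAL homomorphism and regularity of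
`A₁` DESCENDS to `A` (Matsumura 23.7 (i), the tree's `IsRegularLocalRing.of_flat_of_isLocalHom`).

INVENTORY (critic row 207 (i2), F3⁺ «local flat + `𝔪_A C = 𝔪_C` + `dim A = dim C` + `C` regular ⇒ `A` regular»):
NOT re-proved — the tree's Literature theorem `IsRegularLocalRing.of_flat_of_isLocalHom`
(`Literature/AlgebraicGeometry/Resolution/RegularLocalRingsFlatDescent.lean`, [Matsumura1986, Thm. 23.7 (i)] via
Serre) is STRONGER: it needs only `A → C` flat and local (`A` Noetherian local, `C` regular), neither the
`𝔪`-equality nor the dimension equality; so no new descent lemma is stated and none of its would-be hypotheses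
can be probed.  The summit-side `FrobeniusLadderFRationalResolutionFlatPrimeDescent.isRegularLocalRing_atPrime_of_flat`
(p818568) is the same theorem in `Localization.AtPrime` form for a flat ALGEBRA `B → B′`; it is not used here
because the local rings of this node are the subrings `locAtCentre _ O_E` of `E` (an `IsLocalization`, not a
`Localization.AtPrime` type) and the flat object is `A → (A[x])_𝔪` (free `A[x]`, then a localization), to which
the Literature theorem applies verbatim — and importing a `FrobeniusLadder` Theorems file would cross cells. -/

/-- A finitely generated subalgebra over a Noetherian ring is a Noetherian ring, read on its underlying
subring (Hilbert basis theorem, `Algebra.FiniteType.isNoetherianRing`). [folklore] -/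
theorem isNoetherianRing_toSubring_of_fg {R : Type*} [CommRing R] [Algebra R E] [IsNoetherianRing R]
    (S : Subalgebra R E) (hS : S.FG) : IsNoetherianRing S.toSubring := by
  haveI : Algebra.FiniteType R S := (Subalgebra.fg_iff_finiteType S).mp hS
  haveI : IsNoetherianRing S := Algebra.FiniteType.isNoetherianRing R S
  exact isNoetherianRing_of_ringEquiv S
    { toFun := fun y => ⟨(y : E), y.2⟩
      invFun := fun y => ⟨(y : E), y.2⟩
      left_inv := fun _ => rfl
      right_inv := fun _ => rfl
      map_mul' := fun _ _ => rfl
      map_add' := fun _ _ => rfl }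

/-- Integrality over a subring `B` passes to the local ring at the centre of any larger subring `T ⊇ B`.
[folklore] -/
theorem isIntegral_locAtCentre_of_le {B T : Subring E} (hBT : B ≤ T) {x : E} (hx : IsIntegral B x) :
    IsIntegral (locAtCentre T OE) x := by
  obtain ⟨p, hp, hpx⟩ := hx
  have hBA : B ≤ locAtCentre T OE := hBT.trans (le_locAtCentre T OE)
  refine ⟨p.map (Subring.inclusion hBA), hp.map _, ?_⟩
  rw [Polynomial.eval₂_map]
  have : (algebraMap (locAtCentre T OE) E).comp (Subring.inclusion hBA) = algebraMap B E :=
    RingHom.ext fun _ => rfl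
  rw [this, hpx]

section Step

variable (B : Subring E) (x : E)

/-- `(A[x])_𝔪 = (B[x])_𝔪` for `A = B_𝔪`: localising at the centre before adjoining the witness does
not change the local ring. (Sources: NovacoskiSpivakovsky2014, Lemma 2.9.) -/
theorem locAtCentre_adjoin_toSubring_eq :
    locAtCentre (Algebra.adjoin (locAtCentre B OE) ({x} : Set E)).toSubring OE =
      locAtCentre (Subring.closure ((B : Set E) ∪ {x})) OE := by
  rw [Algebra.adjoin_eq_ring_closure]
  have hr : Set.range (algebraMap (locAtCentre B OE) E) = (locAtCentre B OE : Set E) := by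
    ext z
    constructor
    · rintro ⟨w, rfl⟩; exact w.2
    · intro hz; exact ⟨⟨z, hz⟩, rfl⟩
  rw [hr]
  exact locAtCentre_closure_locAtCentre_union B OE {x}

variable {B x}

/-- The subring `B[x]` lies in `O_E` when `B ⊆ O_E` and `x ∈ O_E`. [folklore] -/
theorem closure_insert_le (hBO : B ≤ OE.toSubring) (hxO : x ∈ OE) :
    Subring.closure ((B : Set E) ∪ {x}) ≤ OE.toSubring := by
  refine Subring.closure_le.mpr ?_
  rintro z (hz | hz)
  · exact hBO hz
  · rw [Set.mem_singleton_iff] at hz; rw [hz]; exact hxO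

/-- `A[x] ⊆ O_E` for `A = B_𝔪`, `B ⊆ O_E`, `x ∈ O_E`. [folklore] -/
theorem adjoin_toSubring_le (hBO : B ≤ OE.toSubring) (hxO : x ∈ OE) :
    (Algebra.adjoin (locAtCentre B OE) ({x} : Set E)).toSubring ≤ OE.toSubring := by
  rw [Algebra.adjoin_eq_ring_closure]
  refine Subring.closure_le.mpr ?_
  rintro z (⟨w, rfl⟩ | hz)
  · exact locAtCentre_le hBO w.2
  · rw [Set.mem_singleton_iff] at hz; rw [hz]; exact hxO

/-- `A ⊆ A[x]`. [folklore] -/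
theorem locAtCentre_le_adjoin_toSubring :
    locAtCentre B OE ≤ (Algebra.adjoin (locAtCentre B OE) ({x} : Set E)).toSubring := fun z hz =>
  (Algebra.adjoin (locAtCentre B OE) ({x} : Set E)).algebraMap_mem ⟨z, hz⟩

/-- **Flat local descent for one witness.**  `B ⊆ O_E`, `A = B_𝔪` Noetherian and integrally closed,
`x ∈ O_E` integral over `A`: if `(A[x])_𝔪` is a regular local ring then so is `A` — `A[x]` is free over
`A` (power basis on the minimal polynomial, `A` normal), `(A[x])_𝔪` is a localization of it, so `A → (A[x])_𝔪`
is flat and local, and Matsumura 23.7 (i) applies. (Sources: Matsumura1987, Thm. 23.7 (i).) -/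
theorem isRegularLocalRing_of_adjoin_integral (hBO : B ≤ OE.toSubring) (hxO : x ∈ OE)
    [IsNoetherianRing (locAtCentre B OE)] (hic : IsIntegrallyClosed (locAtCentre B OE))
    (hint : IsIntegral (locAtCentre B OE) x)
    (hreg : IsRegularLocalRing
      (locAtCentre (Algebra.adjoin (locAtCentre B OE) ({x} : Set E)).toSubring OE)) :
    IsRegularLocalRing (locAtCentre B OE) := by
  classical
  set A : Subring E := locAtCentre B OE with hAdef
  haveI : IsLocalRing A := isLocalRing_locAtCentre hBO
  haveI : IsIntegrallyClosed A := hic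
  let T : Subalgebra A E := Algebra.adjoin A ({x} : Set E)
  set B₁ : Subring E := T.toSubring with hB₁def
  set A₁ : Subring E := locAtCentre B₁ OE with hA₁def
  have hB₁O : B₁ ≤ OE.toSubring := adjoin_toSubring_le OE hBO hxO
  have hAB₁ : A ≤ B₁ := locAtCentre_le_adjoin_toSubring OE
  have hAA₁ : A ≤ A₁ := hAB₁.trans (le_locAtCentre B₁ OE)
  haveI : IsRegularLocalRing A₁ := hreg
  -- `A[x]` is free over `A`
  let pb : PowerBasis A T := Algebra.adjoin.powerBasis' hint
  haveI : Module.Free A T := Module.Free.of_basis pb.basis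
  -- the three inclusions `A ⊆ B₁ ⊆ A₁` as algebra structures
  letI algAB₁ : Algebra A B₁ := (Subring.inclusion hAB₁).toAlgebra
  letI algAA₁ : Algebra A A₁ := (Subring.inclusion hAA₁).toAlgebra
  haveI : IsScalarTower A B₁ A₁ := IsScalarTower.of_algebraMap_eq fun _ => rfl
  -- `B₁ = A[x]` as an `A`-module is the subalgebra `T`
  let e : B₁ ≃ₗ[A] T :=
    { toFun := fun y => ⟨y.1, y.2⟩
      invFun := fun y => ⟨y.1, y.2⟩
      map_add' := fun _ _ => rfl
      map_smul' := fun a y => by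
        apply Subtype.ext
        change ((a : E) * (y : E)) = (a : E) • (y : E)
        rw [smul_eq_mul]
      left_inv := fun _ => rfl
      right_inv := fun _ => rfl }
  haveI : Module.Flat A B₁ := Module.Flat.of_linearEquiv e
  haveI := isLocalization_locAtCentre (O := OE) hB₁O
  haveI : Module.Flat B₁ A₁ := IsLocalization.flat A₁ (subringCentre B₁ OE hB₁O).primeCompl
  haveI : Module.Flat A A₁ := Module.Flat.trans A B₁ A₁
  -- `A → A₁` is local: a unit of `A₁` has value `1`, hence is a unit of `A`
  haveI : IsLocalHom (algebraMap A A₁) := by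
    refine ⟨fun a ha => ?_⟩
    by_contra hna
    have hlt : OE.valuation ((a : A) : E) < 1 := (not_isUnit_locAtCentre_iff hBO a).mp hna
    exact (not_isUnit_locAtCentre_iff hB₁O (algebraMap A A₁ a)).mpr hlt ha
  exact IsRegularLocalRing.of_flat_of_isLocalHom A A₁


/-- The derivative of the MINIMAL polynomial of a standard-étale witness is a unit at the centre:
`f = h·q` over the normal ring `A` (`minpoly.isIntegrallyClosed_dvd`), so `f′(x) = h′(x)q(x)` with both
factors in `O_E` and product of value `1`. [folklore] -/
theorem valuation_aeval_derivative_minpoly_eq_one (hBO : B ≤ OE.toSubring) (hxO : x ∈ OE)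
    (hic : IsIntegrallyClosed (locAtCentre B OE))
    {f : E[X]} (hf : ∀ i, f.coeff i ∈ B) (hfm : f.Monic) (hfx : f.eval x = 0)
    (hder : OE.valuation ((derivative f).eval x) = 1) :
    OE.valuation (aeval x (derivative (minpoly (locAtCentre B OE) x))) = 1 := by
  set A : Subring E := locAtCentre B OE with hAdef
  haveI : IsIntegrallyClosed A := hic
  have hAO : A ≤ OE.toSubring := locAtCentre_le hBO
  have hfA : ∀ i, f.coeff i ∈ A := fun i => le_locAtCentre B OE (hf i)
  obtain ⟨f₀, hf₀, hf₀m⟩ := exists_map_eq_of_coeff_mem_subring A hfA hfm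
  have hint : IsIntegral A x := isIntegral_of_monic_root A hfA hfm hfx
  have hf₀x : aeval x f₀ = 0 := by
    rw [Polynomial.aeval_def, ← Polynomial.eval_map, hf₀, hfx]
  obtain ⟨q, hq⟩ := minpoly.isIntegrallyClosed_dvd hint hf₀x
  -- values of `A`-polynomials at `x` lie in `O_E`
  have hvalO : ∀ p : Polynomial A, aeval x p ∈ OE := by
    intro p
    rw [Polynomial.aeval_def, ← Polynomial.eval_map]
    refine eval_mem_of_coeff_mem OE.toSubring (fun i => ?_) hxO
    rw [Polynomial.coeff_map]
    exact hAO (p.coeff i).2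
  have hprod : OE.valuation (aeval x (derivative (minpoly A x))) * OE.valuation (aeval x q) = 1 := by
    rw [← map_mul]
    have h1 : (derivative f).eval x = aeval x (derivative (minpoly A x)) * aeval x q := by
      rw [← hf₀, Polynomial.derivative_map, Polynomial.eval_map, ← Polynomial.aeval_def, hq,
        Polynomial.derivative_mul, map_add, map_mul, map_mul, minpoly.aeval, zero_mul, add_zero]
    rw [← h1, hder]
  have hle1 : OE.valuation (aeval x (derivative (minpoly A x))) ≤ 1 :=
    (OE.valuation_le_one_iff _).mpr (hvalO _)
  have hle2 : OE.valuation (aeval x q) ≤ 1 := (OE.valuation_le_one_iff _).mpr (hvalO _)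
  refine le_antisymm hle1 ?_
  calc (1 : _) = OE.valuation (aeval x (derivative (minpoly A x))) * OE.valuation (aeval x q) := hprod.symm
    _ ≤ OE.valuation (aeval x (derivative (minpoly A x))) * 1 := mul_le_mul' le_rfl hle2
    _ = OE.valuation (aeval x (derivative (minpoly A x))) := mul_one _

end Step

end Summit.ResolutionOfSingularities.ResolutionOfSingularities.Theorems.InertDescentLU

end
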